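import Literature.AlgebraicGeometry.Frobenioids.Thm42Sub
import Literature.AlgebraicGeometry.Frobenioids.PrimesEquivalence
import Literature.AlgebraicGeometry.Frobenioids.PrimesMonoidIsoRight
import HarnessLib

/-!
# [FrdI] Theorem 4.2, sub-DAG rows T42-L08 and T42-L12 — discharges

Mochizuki, *The geometry of Frobenioids I: the general theory*, Kyushu J. Math. **62** (2008)
293–400, §4, Theorem 4.2 (ii)(iii), proof pp. 80–81 [cite: MochizukiFrdI2008, Thm. 4.2 (ii) p.80].
PROOF-ONLY companion of `Thm42Sub.lean`: `FrdI.T42.PsiPrimeBijection` (row L08, from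
`PreFrobenioid.existsUnique_primesEquiv_family`) and `FrdI.T42.MonoidIsosAtDivFrobTrivial` (row L12, from
`PreFrobenioid.exists_rightIso` / `exists_leftIso`; monoid kernel `MonoprimeEquivMul.lean`, seat
abc-iut-L1-d10 = row L13). No new definitions.
-/

namespace Literature.AlgebraicGeometry.Frobenioids

open CategoryTheory Opposite

namespace FrdI.T42

/-- **Row T42-L08 DISCHARGED** (p. 80 ll. 18–33) modulo row L07 (primary steps preserved, a hypothesis of the
row). [cite: MochizukiFrdI2008, Thm. 4.2 (ii) p.80] -/
theorem PsiPrimeBijection_holds : PsiPrimeBijection := by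
  intro D₁ _ Φ₁ C₁ _ D₂ _ Φ₂ C₂ _ F₁ F₂ Ψ S hprim hprim'
  exact PreFrobenioid.existsUnique_primesEquiv_family Ψ S.isFrobenioid₁ S.isFrobenioid₂ S.perfect₁
    S.perfect₂ S.isotropic₁ S.isotropic₂ S.perfFactorial₁ S.perfFactorial₂ S.step_map S.step_inv
    S.preStep_map S.preStep_inv hprim hprim'

/-- **Row T42-L12 DISCHARGED** (p. 81 ll. 32–58), the right-hand and left-hand isomorphisms of monoids.
[cite: MochizukiFrdI2008, Thm. 4.2 (iii) p.81] -/
theorem MonoidIsosAtDivFrobTrivial_holds : MonoidIsosAtDivFrobTrivial := by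
  intro D₁ _ Φ₁ C₁ _ D₂ _ Φ₂ C₂ _ F₁ F₂ Ψ S A hA hdivid 𝔭 𝔭' hea heb
  exact ⟨PreFrobenioid.exists_rightIso Ψ S.isFrobenioid₁ S.isFrobenioid₂ S.isotropic₁ S.isotropic₂
      S.perfFactorial₁ S.perfFactorial₂ S.preStep_map S.preStep_inv S.frobeniusType_map S.degFr_map hA
      hdivid 𝔭 𝔭' hea,
    PreFrobenioid.exists_leftIso Ψ S.isFrobenioid₁ S.isFrobenioid₂ S.isotropic₁ S.isotropic₂
      S.perfFactorial₁ S.perfFactorial₂ S.preStep_map S.preStep_inv S.frobeniusType_map S.degFr_map hA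
      hdivid 𝔭 𝔭' heb⟩

end FrdI.T42

end Literature.AlgebraicGeometry.Frobenioids
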